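import Mathlib

/-!
# Residue rules for the Gaussian unital lift, I: valuation certificates and the cap `|D|² ≤ m` —
stub `stub_tangencySets` (crux `LevelOneGL2Designs`, stmt-MatrixMultiplication-14080), wall-breaker
axis 10/12 "Hermitian unital constructions", generation 1 (seat 3), cycle 2, part 6

The LIFTED unital (axis k7, seat 7-3, `HermitianLift.tangencySet_of_hermitianLift_graph`): over a
commutative ring `O` with involution `σ` and a ring map `O → ZMod p`, the points `(x, x·σx + u)` with
the Hermitian tangents form a tangency set of `AG(2,p)` as soon as (i) nothing wraps around and (ii) no
height difference `(u' + σu') − (u + σu)` is a non-trivial norm `2·(x − x')·σ(x − x')`.  Over a CM field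
of degree `2m` condition (ii) is met by freezing the trace (one real direction lost: exponent
`3/2 − 1/(2m)`); over the Gaussian integers `O = ℤ[i]` (`σ` = conjugation, `p ≡ 1 (mod 4)`, heights
`2·Re u`) it asks for a set `U ⊆ ℤ` of real parts no two of which differ by a positive SUM OF TWO
SQUARES (`Re u' − Re u ≠ a² + b²`, `(a,b) ≠ 0`, for all ordered pairs), and the lift then has
`≍ p^{1/2}·p^{1/2}·|U ∩ [0,p^{1/2})|` points — exponent `1 + γ/2` from `|U ∩ [0,M)| ≍ M^γ` (seat 7-3,
AXIS R8′).  The only known such `U` are DIGIT SETS built from a RESIDUE RULE: a modulus `m` and digits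
`D` such that every difference class `(d − d') + mℤ`, `d ≠ d'`, is free of `±(a² + b²)`; base `9` with
digits `{0,3,6}` gives `γ = 1/2`, i.e. the exponent `5/4` of the parabola lifts again, and seat 7-3's
search found nothing better (`|D| ≤ 21 = √441` mod `9·49`).

This file and its sequel (`…GaussianUnitalResidueRule`) settle the residue-rule method completely:

* `card_le_prod_of_certificates` — the counting kernel: if every pair of a finite `D ⊆ ℤ` is separated
  by an EXACT prime-power certificate `b^k ∥ d − d'` with `(b,k)` from a fixed finite list, then
  `|D| ≤ ∏ b` (the `k`-th base-`b` digits form an injective fingerprint);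
* `card_sq_le_of_certificates` — certificates `(q prime, k odd, q^(k+1) ∣ m)` force `|D|² ≤ m`;
* `not_sq_add_sq_of_certificate`, `residueRule_of_certificate` — such a certificate with
  `q ≡ 3 (mod 4)` makes the whole class `e + mℤ` free of `±(sums of two squares)` (Fermat–Euler:
  `Nat.eq_sq_add_sq_iff`);
* `residueRule_multiples` — the rule `D = q·[0,q)` mod `q²` (`q ≡ 3 (mod 4)`) has `|D|² = q² = m`:
  the cap of part 7 is attained for every such prime (base `9`, digits `{0,3,6}` is `q = 3`).

Part 7 adds the converse (a class free of `±(a²+b²)` HAS such a certificate — Dirichlet) and concludes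
`|D|² ≤ m` for every residue rule: the method cannot pass `γ = 1/2`, the Gaussian door of the lifted
unital cannot pass `p^{5/4}` this way.  Elementary; no definitions.
-/

-- `Summit.MatrixMultiplication.MatrixMultiplication.…` is the tree's mandated summit/problem namespace (D-0017).
set_option linter.dupNamespace false

namespace Summit.MatrixMultiplication.MatrixMultiplication.Theorems.LevelOneGL2Designs.GaussianUnital

open Finset

/-- **Counting kernel (digit fingerprint).**  Let `I` index finitely many pairs `(b i, k i)` of a base
`b i ≥ 1` and an exponent.  If any two distinct elements `d ≠ d'` of a finite `D ⊆ ℤ` are separated by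
some `i ∈ I` in the exact sense `(b i)^(k i) ∣ d − d'` and `(b i)^(k i + 1) ∤ d − d'`, then
`|D| ≤ ∏ i ∈ I, b i`: the vector of `k i`-th base-`b i` digits is injective on `D`, because such a
separation means precisely that the digits below position `k i` agree and the `k i`-th ones differ.
[elementary] -/
theorem card_le_prod_of_certificates {ι : Type*} (I : Finset ι) (b k : ι → ℕ)
    (hb : ∀ i ∈ I, 0 < b i) (D : Finset ℤ)
    (h : ∀ d ∈ D, ∀ d' ∈ D, d ≠ d' →
      ∃ i ∈ I, (b i : ℤ) ^ k i ∣ d - d' ∧ ¬ (b i : ℤ) ^ (k i + 1) ∣ d - d') :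
    D.card ≤ ∏ i ∈ I, b i := by
  classical
  -- the `k i`-th digit of `d` in base `b i`, as a dependent function on `I`
  let f : ℤ → ((i : ι) → i ∈ I → ℕ) := fun d i _ => ((d / (b i : ℤ) ^ k i) % (b i : ℤ)).toNat
  have hmaps : Set.MapsTo f ↑D ↑(I.pi fun i => range (b i)) := by
    intro d _
    rw [mem_coe, Finset.mem_pi]
    intro i hi
    rw [mem_range]
    have hb0 : (0 : ℤ) < b i := by exact_mod_cast hb i hi
    have h1 : 0 ≤ (d / (b i : ℤ) ^ k i) % (b i : ℤ) := Int.emod_nonneg _ hb0.ne'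
    have h2 : (d / (b i : ℤ) ^ k i) % (b i : ℤ) < b i := Int.emod_lt_of_pos _ hb0
    have h3 : (((d / (b i : ℤ) ^ k i) % (b i : ℤ)).toNat : ℤ) < b i := by
      rw [Int.toNat_of_nonneg h1]; exact h2
    exact_mod_cast h3
  have hinj : Set.InjOn f ↑D := by
    intro d hd d' hd' hfd
    by_contra hne
    obtain ⟨i, hi, hdvd, hndvd⟩ := h d hd d' hd' hne
    have hb0 : (0 : ℤ) < b i := by exact_mod_cast hb i hi
    have hdig : ((d / (b i : ℤ) ^ k i) % (b i : ℤ)).toNat =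
        ((d' / (b i : ℤ) ^ k i) % (b i : ℤ)).toNat := by
      have := congrFun (congrFun hfd i) hi
      simpa [f] using this
    have hmod : (d / (b i : ℤ) ^ k i) % (b i : ℤ) = (d' / (b i : ℤ) ^ k i) % (b i : ℤ) := by
      rw [← Int.toNat_of_nonneg (Int.emod_nonneg (d / (b i : ℤ) ^ k i) hb0.ne'),
        ← Int.toNat_of_nonneg (Int.emod_nonneg (d' / (b i : ℤ) ^ k i) hb0.ne'), hdig]
    -- the remainders mod `b^k` agree, so `d - d' = b^k · (d / b^k - d' / b^k)`
    have hr : d % (b i : ℤ) ^ k i = d' % (b i : ℤ) ^ k i :=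
      (Int.emod_eq_emod_iff_emod_sub_eq_zero).mpr (Int.emod_eq_zero_of_dvd hdvd)
    have e1 := Int.mul_ediv_add_emod d ((b i : ℤ) ^ k i)
    have e2 := Int.mul_ediv_add_emod d' ((b i : ℤ) ^ k i)
    have hd_eq : d - d' = (b i : ℤ) ^ k i * (d / (b i : ℤ) ^ k i - d' / (b i : ℤ) ^ k i) := by
      linear_combination -e1 + e2 + hr
    -- and the quotients agree mod `b`, so `b^(k+1) ∣ d - d'`
    have hq_dvd : (b i : ℤ) ∣ d / (b i : ℤ) ^ k i - d' / (b i : ℤ) ^ k i :=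
      Int.dvd_of_emod_eq_zero ((Int.emod_eq_emod_iff_emod_sub_eq_zero).mp hmod)
    apply hndvd
    rw [hd_eq, pow_succ]
    exact mul_dvd_mul_left _ hq_dvd
  calc D.card ≤ (I.pi fun i => range (b i)).card := Finset.card_le_card_of_injOn f hmaps hinj
    _ = ∏ i ∈ I, b i := by rw [Finset.card_pi]; simp only [card_range]

/-- **The cap for odd prime-power certificates below the precision of `m`.**  If any two distinct
elements of `D ⊆ ℤ` are separated by a certificate `q^k ∥ d − d'` with `q` prime, `k` odd and
`q^(k+1) ∣ m`, then `|D|² ≤ m`.  (The available certificates are `(q, 2j+1)` with `j < v_q(m)/2`, and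
`∏_q q^(2·⌊v_q(m)/2⌋)` divides `m`.) [elementary] -/
theorem card_sq_le_of_certificates (m : ℕ) (hm : 0 < m) (D : Finset ℤ)
    (h : ∀ d ∈ D, ∀ d' ∈ D, d ≠ d' → ∃ q k : ℕ, q.Prime ∧ Odd k ∧ q ^ (k + 1) ∣ m ∧
      (q : ℤ) ^ k ∣ d - d' ∧ ¬ (q : ℤ) ^ (k + 1) ∣ d - d') :
    D.card ^ 2 ≤ m := by
  classical
  -- certificates `(q, 2j+1)` with `q^(2j+2) ∣ m`, indexed by `⟨q, j⟩` with `j < v_q(m) / 2`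
  set I : Finset (Σ _ : ℕ, ℕ) := m.primeFactors.sigma fun q => range (m.factorization q / 2) with hI
  have hD : D.card ≤ ∏ i ∈ I, i.1 := by
    refine card_le_prod_of_certificates I (fun i => i.1) (fun i => 2 * i.2 + 1) ?_ D ?_
    · intro i hi
      rw [hI, Finset.mem_sigma] at hi
      exact (Nat.prime_of_mem_primeFactors hi.1).pos
    · intro d hd d' hd' hne
      obtain ⟨q, k, hq, ⟨j, rfl⟩, hqm, hdvd, hndvd⟩ := h d hd d' hd' hne
      have hle : 2 * j + 1 + 1 ≤ m.factorization q :=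
        (hq.pow_dvd_iff_le_factorization hm.ne').mp hqm
      have hjq : j < m.factorization q / 2 := by omega
      refine ⟨⟨q, j⟩, ?_, hdvd, hndvd⟩
      rw [hI, Finset.mem_sigma, mem_range, Nat.mem_primeFactors]
      exact ⟨⟨hq, (dvd_pow_self q (by omega)).trans hqm, hm.ne'⟩, hjq⟩
  have hprod : ∏ i ∈ I, i.1 = ∏ q ∈ m.primeFactors, q ^ (m.factorization q / 2) := by
    rw [hI, Finset.prod_sigma]
    refine Finset.prod_congr rfl fun q _ => ?_
    rw [Finset.prod_const, card_range]
  have hself : ∏ q ∈ m.primeFactors, q ^ m.factorization q = m := by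
    conv_rhs => rw [← Nat.prod_factorization_pow_eq_self hm.ne']
    rw [Finsupp.prod, Nat.support_factorization]
  calc D.card ^ 2 ≤ (∏ q ∈ m.primeFactors, q ^ (m.factorization q / 2)) ^ 2 := by
        rw [← hprod]; exact Nat.pow_le_pow_left hD 2
    _ = ∏ q ∈ m.primeFactors, q ^ (2 * (m.factorization q / 2)) := by
        rw [← Finset.prod_pow]
        exact Finset.prod_congr rfl fun q _ => by ring
    _ ≤ ∏ q ∈ m.primeFactors, q ^ m.factorization q :=
        Finset.prod_le_prod (fun q _ => Nat.zero_le _) fun q hq =>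
          Nat.pow_le_pow_right (Nat.prime_of_mem_primeFactors hq).pos (Nat.mul_div_le _ 2)
    _ = m := hself

/-- **Certificates are sound (Fermat–Euler).**  If `q ≡ 3 (mod 4)` is prime, `k` is odd and
`q^k ∥ n` (`q^k ∣ n`, `q^(k+1) ∤ n`), then `|n|` is not a sum of two squares: the exponent of `q` in
`|n|` is the odd number `k`. [Mathlib `Nat.eq_sq_add_sq_iff`] -/
theorem not_sq_add_sq_of_certificate {q k : ℕ} (hq : q.Prime) (hq3 : q % 4 = 3) (hk : Odd k)
    {n : ℤ} (h1 : (q : ℤ) ^ k ∣ n) (h2 : ¬ (q : ℤ) ^ (k + 1) ∣ n) :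
    ¬ ∃ x y : ℕ, n.natAbs = x ^ 2 + y ^ 2 := by
  haveI := Fact.mk hq
  have hn : n ≠ 0 := by rintro rfl; exact h2 (dvd_zero _)
  have hn' : n.natAbs ≠ 0 := Int.natAbs_ne_zero.mpr hn
  have h1' : q ^ k ∣ n.natAbs := by rwa [← Int.natCast_dvd, Nat.cast_pow]
  have h2' : ¬ q ^ (k + 1) ∣ n.natAbs := by rwa [← Int.natCast_dvd, Nat.cast_pow]
  have hv : padicValNat q n.natAbs = k := by
    have hle : k ≤ padicValNat q n.natAbs := (padicValNat_dvd_iff_le hn').mp h1'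
    have hlt : ¬ k + 1 ≤ padicValNat q n.natAbs := fun h => h2' ((padicValNat_dvd_iff_le hn').mpr h)
    omega
  rw [Nat.eq_sq_add_sq_iff]
  intro H
  have hk0 : k ≠ 0 := fun h0 => by simp [h0] at hk
  have hqmem : q ∈ n.natAbs.primeFactors :=
    Nat.mem_primeFactors.mpr ⟨hq, (dvd_pow_self q hk0).trans h1', hn'⟩
  have := H q hqmem hq3
  rw [hv] at this
  exact (Nat.not_even_iff_odd.mpr hk) this

/-- **A certificate below the precision of `m` clears the whole residue class.**  If `q ≡ 3 (mod 4)`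
is prime, `k` odd, `q^(k+1) ∣ m` and `q^k ∥ e`, then NO `n ≡ e (mod m)` has `|n|` a sum of two squares
(the class has constant `q`-adic valuation `k`).  This is the mechanism of every residue rule for the
Gaussian unital lift, e.g. base `9`, digits `{0,3,6}` (`q = 3`, `k = 1`). [elementary] -/
theorem residueRule_of_certificate {m : ℕ} {e : ℤ} {q k : ℕ} (hq : q.Prime) (hq3 : q % 4 = 3)
    (hk : Odd k) (hqm : q ^ (k + 1) ∣ m) (h1 : (q : ℤ) ^ k ∣ e) (h2 : ¬ (q : ℤ) ^ (k + 1) ∣ e) :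
    ∀ n : ℤ, (m : ℤ) ∣ n - e → ¬ ∃ x y : ℕ, n.natAbs = x ^ 2 + y ^ 2 := by
  intro n hn
  have hkm1 : (q : ℤ) ^ (k + 1) ∣ (m : ℤ) := by exact_mod_cast hqm
  have hkm : (q : ℤ) ^ k ∣ (m : ℤ) := (pow_dvd_pow (q : ℤ) (Nat.le_succ k)).trans hkm1
  refine not_sq_add_sq_of_certificate hq hq3 hk ?_ ?_
  · have := dvd_add (hkm.trans hn) h1
    simpa using this
  · intro h3
    apply h2
    have := dvd_sub h3 (hkm1.trans hn)
    simpa using this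

/-- **The cap is attained: the rule `q·[0,q)` modulo `q²`.**  For a prime `q` the `q` multiples
`0, q, …, (q−1)q` are pairwise separated by the certificate `(q, 1)` below the precision of `m = q²`
(`q ∥ d − d'`), so `card_sq_le_of_certificates` is sharp (`|D|² = q² = m`); for `q ≡ 3 (mod 4)` this
is a residue rule for the Gaussian unital lift (`residueRule_of_certificate`), `q = 3` being base `9`
with digits `{0,3,6}`. [elementary] -/
theorem residueRule_multiples (q : ℕ) (hq : q.Prime) :
    ((range q).image fun t : ℕ => ((q * t : ℕ) : ℤ)).card = q ∧
    ∀ d ∈ (range q).image fun t : ℕ => ((q * t : ℕ) : ℤ),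
      ∀ d' ∈ (range q).image fun t : ℕ => ((q * t : ℕ) : ℤ), d ≠ d' →
        (q : ℤ) ^ 1 ∣ d - d' ∧ ¬ (q : ℤ) ^ (1 + 1) ∣ d - d' := by
  have hq0 : 0 < q := hq.pos
  constructor
  · rw [card_image_of_injective _ fun t t' (htt : ((q * t : ℕ) : ℤ) = ((q * t' : ℕ) : ℤ)) => ?_,
      card_range]
    have : q * t = q * t' := by exact_mod_cast htt
    exact Nat.eq_of_mul_eq_mul_left hq0 this
  · intro d hd d' hd' hne
    simp only [mem_image, mem_range] at hd hd'
    obtain ⟨t, ht, rfl⟩ := hd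
    obtain ⟨t', ht', rfl⟩ := hd'
    push_cast
    refine ⟨⟨(t : ℤ) - t', by ring⟩, fun ⟨c, hc⟩ => hne ?_⟩
    -- `q² ∣ q (t - t')` forces `q ∣ t - t'`, impossible for `t ≠ t'` in `[0,q)`
    have hq0' : (q : ℤ) ≠ 0 := by exact_mod_cast hq0.ne'
    have htt : (t : ℤ) - t' = q * c := by
      have : (q : ℤ) * ((t : ℤ) - t') = q * (q * c) := by linear_combination hc
      exact mul_left_cancel₀ hq0' this
    have habs : |(t : ℤ) - t'| < q := by
      rw [abs_sub_lt_iff]; constructor <;> omega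
    rw [htt, abs_mul, Nat.abs_cast] at habs
    have hc0 : c = 0 := by
      by_contra hc0
      have : (1 : ℤ) ≤ |c| := Int.one_le_abs hc0
      nlinarith
    rw [hc0, mul_zero, sub_eq_zero] at htt
    push_cast
    rw [htt]

end Summit.MatrixMultiplication.MatrixMultiplication.Theorems.LevelOneGL2Designs.GaussianUnital
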